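/-
Copyright (c) 2026 the pub-hodgecm-mathlib formalisation cell (harness21).  Prover seat hodgecm-mathlib-A-p19 (g27), 2026-09-02.  Road «S3-tree»∕«S3-ram» (LEAD F0P3a-plan (g12)
T11-41∕T11-52; owner p06 (g15)), row (e2) «P-2-ram», organ «(D2-β)-ram, part T₀: RESIDUE SQUARES OF THE UNRAMIFIED QUADRATIC EXTENSION IN COORDINATES» — the finite-field
norm∕square law feeding the type-A translation theorem (★-to-be `UnramifiedQuadraticNormTransferTypeA`), over ★ `UnramifiedQuadraticDictionary` (part L, this seat).
-/
import Literature.NumberTheory.NumberFields.UnramifiedQuadraticDictionary   -- ★ part L (this seat): the frame `K = E_w = F_v(θ)`, `toPlace`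
import HarnessLib

/-!
# Residue squares of the unramified quadratic extension `K = F_v(θ)` in coordinates: `ū` is a square in `𝓀_K` iff `N(ū) = ā² − b̄²d̄` is a square in `𝓀_F`
# (Serre, *Local Fields* XIV §4; Neukirch II (4.3))

Topic `NumberTheory/NumberFields`; namespace `Literature.NumberTheory.NumberFields`.  THEOREMS ONLY (no definition, no instance, no notation, no named fact, no `sorry`); kernel lane
`--supports stmt-HodgeConjecture-24833`.  Cell `pub/hodgecm-mathlib` (D-0151), crux H413; road «S3-tree», seeding wave «S3-ram», row (e2) «P-2-ram»; organ **«(D2-β)-ram, part T₀»**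
(this seat).  Frame of ★ `UnramifiedQuadraticDictionary`: `K = E_w`, `ι₁ = toPlace v w`, `θ² = ι₁ d` with `d` a unit of `F_v` that is residually a NON-square (`hdres`), `|2| = 1`,
`|ι₁p + ι₁qθ| = max(|p|, |q|)` (`hval`) and every element has coordinates (`hcoord`); plus the residue dichotomy `hsqF` «every unit of `F_v` is residually `r²` or `r²·d`» (the residue
field `𝓀_F` being finite of odd characteristic with `d̄ ∉ 𝓀_F^{×2}`).

* **`exists_sq_near_iff_exists_sq_near_norm`** — for a unit `u = ι₁a + ι₁bθ` of `𝒪[K]` (`max(|a|,|b|) = 1`):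
  `(∃ t ∈ 𝒪[K], |u − t²| < 1) ↔ ∃ c ∈ 𝒪[F_v], |a² − b²d − c²| < 1` — the finite-field law «`x̄ ∈ 𝔽_{q²}` is a square iff `N_{𝔽_{q²}∕𝔽_q}(x̄)` is a square in `𝔽_q`» written
  residue-free, proved by completing the square in coordinates (no Frobenius, no cardinalities).  Consumer: the type-A translation theorem (`σ_K = s̃` residually trivial, so
  `u ∈ N_{s̃} ⟺ ū` square, while `u·ι′u = ι₁(a² − b²d) ∈ ι₁N(F_v) ⟺ a² − b²d` residually a square).  HONEST LABEL: HC_CM is proved only modulo the 2 remaining named inputs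
  (hLiu418 24832, h413 24833) until rung 0 closes; local algebra, count-neutral.

## References
* [SerreLocalFields1979] J.-P. Serre, *Local Fields*, GTM 67 (1979): Ch. XIV §4 (local symbols, `p ≠ 2`: units modulo squares detected residually), Ch. V §3 Cor. 2.
* [Neukirch1999] J. Neukirch, *Algebraic Number Theory*, Grundlehren 322 (1999): Ch. II (4.3) (squares in finite and `𝔭`-adic unit groups), Ch. V (1.2).
-/

set_option autoImplicit false

noncomputable section

open NumberField IsDedekindDomain Polynomial
open scoped ValuativeRel
open Literature.NumberTheory.Automorphic Literature.NumberTheory.Automorphic.UnitaryGroup Literature.NumberTheory.LocalFields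

namespace Literature.NumberTheory.NumberFields

variable {F : Type} (E : Type) [Field F] [NumberField F] [Field E] [NumberField E] [Algebra F E]
  (v : HeightOneSpectrum (𝓞 F)) (w : PlacesOver E v)

/-! ## §1 Residue squares of `K = F_v(θ)` in coordinates -/

/-- **RESIDUE SQUARES OF `K = F_v(θ)` IN COORDINATES («`ū ∈ 𝓀_K^{×2} ⟺ N_{𝓀_K∕𝓀_F}(ū) ∈ 𝓀_F^{×2}`»).**  For `d` a unit of `F_v` that is residually a NON-square, `θ² = ι₁ d`, `|2| = 1`, and the
residue dichotomy «every unit of `F_v` is residually `r²` or `r²·d`» (`hsqF`): a unit `u = ι₁ a + ι₁ b θ` of `𝒪[K]` (`max(|a|,|b|) = 1`) is residually a square in `K` if and only if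
its norm `a² − b²·d` is residually a square in `F_v`.  (⇒) `u ≡ (ι₁x + ι₁yθ)²` forces `a ≡ x² + y²d`, `b ≡ 2xy`, so `a² − b²d ≡ (x² − y²d)²`.  (⇐) If `|b| < 1` then `u ≡ ι₁ a ≡ (ι₁ r)²` or
`(ι₁ r θ)²`; if `|b| = 1` and `a² − b²d ≡ c²`, then `(a + c)(a − c) ≡ b²d` is residually a non-square, so exactly one of `(a ± c)∕2` is residually a square `x²` (`x` a unit), and
`t := ι₁ x + ι₁(b∕2x)·θ` has `t² ≡ u` (`4x²(a − x² − b²d∕4x²) = (a² − b²d − c²) − ε(ε + 2c)`, `ε := 2x² − (a + c)`).  This is the finite-field fact «`x ∈ 𝔽_{q²}` is a square iff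
`N(x) ∈ 𝔽_q` is a square» written residue-free. [cite: SerreLocalFields1979, Ch. V §3 Cor. 2; Ch. XIV §4] [cite: Neukirch1999, Ch. II (4.3), Ch. V (1.2)] -/
theorem exists_sq_near_iff_exists_sq_near_norm (h2F : Valued.v (2 : v.adicCompletion F) = 1) {d : v.adicCompletion F} (hdv : Valued.v d = 1)
    (hdres : ∀ c : v.adicCompletion F, Valued.v c ≤ 1 → ¬ Valued.v (d - c ^ 2) < 1)
    (hsqF : ∀ g : v.adicCompletion F, Valued.v g = 1 →
      ∃ r : v.adicCompletion F, Valued.v r ≤ 1 ∧ (Valued.v (g - r ^ 2) < 1 ∨ Valued.v (g - r ^ 2 * d) < 1))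
    {θ : w.1.adicCompletion E} (hθ : θ ^ 2 = toPlace v w d)
    (hval : ∀ p q : v.adicCompletion F, Valued.v (toPlace v w p + toPlace v w q * θ) = max (Valued.v p) (Valued.v q))
    (hcoord : ∀ z : w.1.adicCompletion E, ∃ pq : v.adicCompletion F × v.adicCompletion F, z = toPlace v w pq.1 + toPlace v w pq.2 * θ)
    (a b : v.adicCompletion F) (ha : Valued.v a ≤ 1) (hb : Valued.v b ≤ 1) (hab : max (Valued.v a) (Valued.v b) = 1) :
    (∃ t : w.1.adicCompletion E, Valued.v t ≤ 1 ∧ Valued.v (toPlace v w a + toPlace v w b * θ - t ^ 2) < 1) ↔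
      ∃ c : v.adicCompletion F, Valued.v c ≤ 1 ∧ Valued.v (a ^ 2 - b ^ 2 * d - c ^ 2) < 1 := by
  have hιv : ∀ x, Valued.v (toPlace v w x) = Valued.v x := fun x => by
    have h := hval x 0
    rwa [map_zero, zero_mul, add_zero, map_zero, max_eq_left zero_le] at h
  have hθv : Valued.v θ = 1 := by
    have h := hval 0 1
    rwa [map_zero, map_one, zero_add, one_mul, map_zero, map_one, max_eq_right zero_le] at h
  -- products `p·q` with `|p| < 1`, `|q| ≤ 1` are residually zero; unit products have unit factors
  have hmul_lt : ∀ p q : v.adicCompletion F, Valued.v p < 1 → Valued.v q ≤ 1 → Valued.v (p * q) < 1 := fun p q hp hq => by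
    rw [map_mul]
    calc Valued.v p * Valued.v q ≤ Valued.v p := mul_le_of_le_one_right' hq
      _ < 1 := hp
  have hunit : ∀ p q : v.adicCompletion F, Valued.v p ≤ 1 → Valued.v q ≤ 1 → Valued.v (p * q) = 1 → Valued.v p = 1 := fun p q hp hq h =>
    le_antisymm hp (not_lt.1 fun hlt => absurd h (hmul_lt p q hlt hq).ne)
  have hsq1 : ∀ p : v.adicCompletion F, Valued.v p ≤ 1 → Valued.v (p ^ 2) = 1 → Valued.v p = 1 := fun p hp h =>
    hunit p p hp hp (by rw [← pow_two]; exact h)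
  -- squares in the unramified coordinates
  have hsqc : ∀ x y : v.adicCompletion F,
      (toPlace v w x + toPlace v w y * θ) ^ 2 = toPlace v w (x ^ 2 + y ^ 2 * d) + toPlace v w (2 * x * y) * θ := by
    intro x y
    have h3 : (toPlace v w x + toPlace v w y * θ) ^ 2 = toPlace v w x ^ 2 + toPlace v w y ^ 2 * θ ^ 2 + 2 * toPlace v w x * toPlace v w y * θ := by ring
    rw [h3, hθ, map_add, map_mul, map_mul, map_mul, map_pow, map_pow, map_ofNat]
  constructor
  · rintro ⟨t, ht1, hut⟩
    obtain ⟨⟨x, y⟩, rfl⟩ := hcoord t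
    have hxy : Valued.v x ≤ 1 ∧ Valued.v y ≤ 1 := by
      rw [hval] at ht1
      exact ⟨le_trans (le_max_left _ _) ht1, le_trans (le_max_right _ _) ht1⟩
    have hdiff : toPlace v w a + toPlace v w b * θ - (toPlace v w x + toPlace v w y * θ) ^ 2
        = toPlace v w (a - (x ^ 2 + y ^ 2 * d)) + toPlace v w (b - 2 * x * y) * θ := by
      rw [hsqc, map_sub, map_sub]; ring
    rw [hdiff, hval] at hut
    have h1 : Valued.v (a - (x ^ 2 + y ^ 2 * d)) < 1 := lt_of_le_of_lt (le_max_left _ _) hut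
    have h2 : Valued.v (b - 2 * x * y) < 1 := lt_of_le_of_lt (le_max_right _ _) hut
    have hS : Valued.v (x ^ 2 + y ^ 2 * d) ≤ 1 := by
      refine le_trans (Valuation.map_add _ _ _) (max_le ?_ ?_)
      · rw [map_pow]; exact pow_le_one' hxy.1 2
      · rw [map_mul, map_pow, hdv, mul_one]; exact pow_le_one' hxy.2 2
    refine ⟨x ^ 2 - y ^ 2 * d, ?_, ?_⟩
    · refine le_trans (Valuation.map_sub _ _ _) (max_le ?_ ?_)
      · rw [map_pow]; exact pow_le_one' hxy.1 2
      · rw [map_mul, map_pow, hdv, mul_one]; exact pow_le_one' hxy.2 2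
    · have hid : a ^ 2 - b ^ 2 * d - (x ^ 2 - y ^ 2 * d) ^ 2
          = (a - (x ^ 2 + y ^ 2 * d)) * (a + (x ^ 2 + y ^ 2 * d)) - (b - 2 * x * y) * ((b + 2 * x * y) * d) := by ring
      rw [hid]
      refine lt_of_le_of_lt (Valuation.map_sub _ _ _) (max_lt (hmul_lt _ _ h1 ?_) (hmul_lt _ _ h2 ?_))
      · exact le_trans (Valuation.map_add _ _ _) (max_le ha hS)
      · rw [map_mul, hdv, mul_one]
        refine le_trans (Valuation.map_add _ _ _) (max_le hb ?_)
        rw [map_mul, map_mul, h2F, one_mul]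
        exact mul_le_one' hxy.1 hxy.2
  · rintro ⟨c, hc1, hN⟩
    rcases hb.lt_or_eq with hb1 | hb1
    · -- `|b| < 1`, so `|a| = 1` and `u ≡ ι₁ a ≡ (ι₁ r)²` or `(ι₁ r θ)²`
      have ha1 : Valued.v a = 1 := by
        rcases max_choice (Valued.v a) (Valued.v b) with h | h
        · rw [h] at hab; exact hab
        · rw [h] at hab; exact absurd hab hb1.ne
      obtain ⟨r, hr1, hr⟩ := hsqF a ha1
      rcases hr with hr | hr
      · refine ⟨toPlace v w r, by rw [hιv]; exact hr1, ?_⟩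
        have hdiff : toPlace v w a + toPlace v w b * θ - toPlace v w r ^ 2 = toPlace v w (a - r ^ 2) + toPlace v w b * θ := by
          rw [map_sub, map_pow]; ring
        rw [hdiff, hval]; exact max_lt hr hb1
      · refine ⟨toPlace v w r * θ, by rw [map_mul, hιv, hθv, mul_one]; exact hr1, ?_⟩
        have hdiff : toPlace v w a + toPlace v w b * θ - (toPlace v w r * θ) ^ 2 = toPlace v w (a - r ^ 2 * d) + toPlace v w b * θ := by
          rw [mul_pow, hθ, map_sub, map_mul, map_pow]; ring
        rw [hdiff, hval]; exact max_lt hr hb1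
    · -- `|b| = 1`: the norm `a² − b²d` is a unit, `c` is a unit, `(a + c)(a − c) ≡ b²d` is a unit and residually a NON-square
      have hb0 : b ≠ 0 := fun h => by rw [h, map_zero] at hb1; exact zero_ne_one hb1
      have h20 : (2 : v.adicCompletion F) ≠ 0 := fun h => by rw [h, map_zero] at h2F; exact zero_ne_one h2F
      have hbd : Valued.v (b ^ 2 * d) = 1 := by rw [map_mul, map_pow, hb1, hdv, one_pow, one_mul]
      have hN1 : Valued.v (a ^ 2 - b ^ 2 * d) = 1 := by
        have hle : Valued.v (a ^ 2 - b ^ 2 * d) ≤ 1 :=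
          le_trans (Valuation.map_sub _ _ _) (max_le (by rw [map_pow]; exact pow_le_one' ha 2) hbd.le)
        refine le_antisymm hle (not_lt.1 fun hlt => hdres (a / b) ?_ ?_)
        · rw [map_div₀, hb1, div_one]; exact ha
        · have hid : d - (a / b) ^ 2 = -(a ^ 2 - b ^ 2 * d) / b ^ 2 := by field_simp; ring
          rw [hid, map_div₀, Valuation.map_neg, map_pow, hb1, one_pow, div_one]; exact hlt
      have hc0 : Valued.v c = 1 := by
        refine hsq1 c hc1 ?_
        rw [← hN1]
        refine Valuation.map_eq_of_sub_lt _ ?_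
        rw [hN1, Valuation.map_sub_swap]; exact hN
      have hprod : (a + c) * (a - c) = b ^ 2 * d + (a ^ 2 - b ^ 2 * d - c ^ 2) := by ring
      have hprod1 : Valued.v ((a + c) * (a - c)) = 1 := by
        rw [hprod, Valuation.map_add_eq_of_lt_left _ (by rw [hbd]; exact hN), hbd]
      have hGp_le : Valued.v (a + c) ≤ 1 := le_trans (Valuation.map_add _ _ _) (max_le ha hc1)
      have hGm_le : Valued.v (a - c) ≤ 1 := le_trans (Valuation.map_sub _ _ _) (max_le ha hc1)
      have hGp : Valued.v (a + c) = 1 := hunit _ _ hGp_le hGm_le hprod1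
      have hGm : Valued.v (a - c) = 1 := hunit _ _ hGm_le hGp_le (by rw [mul_comm]; exact hprod1)
      -- the dichotomy for the units `(a ± c)∕2`, cleared of the denominator
      have hdich : ∀ g : v.adicCompletion F, Valued.v g = 1 →
          ∃ r, Valued.v r ≤ 1 ∧ (Valued.v (g - 2 * r ^ 2) < 1 ∨ Valued.v (g - 2 * r ^ 2 * d) < 1) := by
        intro g hg
        obtain ⟨r, hr1, hr⟩ := hsqF (g / 2) (by rw [map_div₀, hg, h2F, div_one])
        refine ⟨r, hr1, ?_⟩
        have e1 : g - 2 * r ^ 2 = 2 * (g / 2 - r ^ 2) := by field_simp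
        have e2 : g - 2 * r ^ 2 * d = 2 * (g / 2 - r ^ 2 * d) := by field_simp
        rcases hr with h | h
        · left; rw [e1, map_mul, h2F, one_mul]; exact h
        · right; rw [e2, map_mul, h2F, one_mul]; exact h
      -- the core construction: `a + c' ≡ 2x²` with `a² − b²d ≡ c'²` gives `t := ι₁ x + ι₁(b∕2x) θ` with `t² ≡ u`
      have core : ∀ c' : v.adicCompletion F, Valued.v c' ≤ 1 → Valued.v (a ^ 2 - b ^ 2 * d - c' ^ 2) < 1 → Valued.v (a + c') = 1 →
          ∀ x : v.adicCompletion F, Valued.v x ≤ 1 → Valued.v (a + c' - 2 * x ^ 2) < 1 →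
          ∃ t : w.1.adicCompletion E, Valued.v t ≤ 1 ∧ Valued.v (toPlace v w a + toPlace v w b * θ - t ^ 2) < 1 := by
        intro c' hc'1 hN' hG x hx1 hx
        have hx0 : Valued.v x = 1 := by
          have h2x : Valued.v (2 * x ^ 2) = 1 := by
            rw [← hG]
            refine Valuation.map_eq_of_sub_lt _ ?_
            rw [hG, Valuation.map_sub_swap]; exact hx
          rw [map_mul, h2F, one_mul] at h2x
          exact hsq1 x hx1 h2x
        have hxne : x ≠ 0 := fun h => by rw [h, map_zero] at hx0; exact zero_ne_one hx0
        set m : v.adicCompletion F := b / (2 * x) with hm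
        have hmb : 2 * x * m = b := by rw [hm]; field_simp
        have hm1 : Valued.v m ≤ 1 := by rw [hm, map_div₀, map_mul, h2F, hx0, one_mul, div_one]; exact hb
        refine ⟨toPlace v w x + toPlace v w m * θ, by rw [hval]; exact max_le hx1 hm1, ?_⟩
        have hdiff : toPlace v w a + toPlace v w b * θ - (toPlace v w x + toPlace v w m * θ) ^ 2 = toPlace v w (a - x ^ 2 - m ^ 2 * d) := by
          rw [hsqc, hmb, map_sub, map_sub, map_add, map_mul, map_pow]; ring
        rw [hdiff, hιv]
        have key : (2 * x) ^ 2 * (a - x ^ 2 - m ^ 2 * d)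
            = (a ^ 2 - b ^ 2 * d - c' ^ 2) - (2 * x ^ 2 - (a + c')) * ((2 * x ^ 2 - (a + c')) + 2 * c') := by
          rw [← hmb]; ring
        have h4 : Valued.v ((2 * x) ^ 2) = 1 := by rw [map_pow, map_mul, h2F, hx0, one_mul, one_pow]
        have hlt : Valued.v ((2 * x) ^ 2 * (a - x ^ 2 - m ^ 2 * d)) < 1 := by
          rw [key]
          have hε : Valued.v (2 * x ^ 2 - (a + c')) < 1 := by rw [Valuation.map_sub_swap]; exact hx
          refine lt_of_le_of_lt (Valuation.map_sub _ _ _) (max_lt hN' (hmul_lt _ _ hε ?_))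
          refine le_trans (Valuation.map_add _ _ _) (max_le hε.le ?_)
          rw [map_mul, h2F, one_mul]; exact hc'1
        rwa [map_mul, h4, one_mul] at hlt
      obtain ⟨x, hx1, hx⟩ := hdich (a + c) hGp
      rcases hx with hx | hx
      · exact core c hc1 hN hGp x hx1 hx
      obtain ⟨x', hx'1, hx'⟩ := hdich (a - c) hGm
      rcases hx' with hx' | hx'
      · exact core (-c) (by rw [Valuation.map_neg]; exact hc1) (by rw [neg_sq]; exact hN) (by rw [← sub_eq_add_neg]; exact hGm) x' hx'1
          (by rw [← sub_eq_add_neg]; exact hx')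
      · -- both `(a ± c)∕2` residually of class `d`: then `b²d ≡ (2xx'd)²`, i.e. `d` is residually a square — contradiction
        exfalso
        have hid2 : (a + c) * (a - c) - 4 * x ^ 2 * x' ^ 2 * d ^ 2
            = (a + c - 2 * x ^ 2 * d) * (a - c) + (2 * x ^ 2 * d) * (a - c - 2 * x' ^ 2 * d) := by ring
        have h2xd : Valued.v (2 * x ^ 2 * d) ≤ 1 := by
          rw [map_mul, map_mul, h2F, one_mul, hdv, mul_one, map_pow]; exact pow_le_one' hx1 2
        have hlt1 : Valued.v ((a + c) * (a - c) - 4 * x ^ 2 * x' ^ 2 * d ^ 2) < 1 := by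
          rw [hid2]
          refine lt_of_le_of_lt (Valuation.map_add _ _ _) (max_lt (hmul_lt _ _ hx hGm_le) ?_)
          rw [mul_comm]; exact hmul_lt _ _ hx' h2xd
        have hid : b ^ 2 * d - (2 * x * x' * d) ^ 2 = ((a + c) * (a - c) - 4 * x ^ 2 * x' ^ 2 * d ^ 2) - (a ^ 2 - b ^ 2 * d - c ^ 2) := by ring
        have hlt2 : Valued.v (b ^ 2 * d - (2 * x * x' * d) ^ 2) < 1 := by
          rw [hid]; exact lt_of_le_of_lt (Valuation.map_sub _ _ _) (max_lt hlt1 hN)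
        refine hdres (2 * x * x' * d / b) ?_ ?_
        · rw [map_div₀, hb1, div_one, map_mul, map_mul, map_mul, h2F, one_mul, hdv, mul_one]
          exact mul_le_one' hx1 hx'1
        · have hid3 : d - (2 * x * x' * d / b) ^ 2 = (b ^ 2 * d - (2 * x * x' * d) ^ 2) / b ^ 2 := by field_simp
          rw [hid3, map_div₀, map_pow, hb1, one_pow, div_one]; exact hlt2

end Literature.NumberTheory.NumberFields

end
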